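import Summits.BirchSwinnertonDyer.BirchSwinnertonDyer.Theorems.EisensteinPrimesX1AlgebraicLambdaGEBudget
import Summits.BirchSwinnertonDyer.BirchSwinnertonDyer.Theorems.EisensteinPrimesX2AnalyticLambdaCertificate
import Summits.BirchSwinnertonDyer.BirchSwinnertonDyer.Theorems.Rank1ResidualX1Isogeny
import Summits.BirchSwinnertonDyer.Rank1Residual.X1.TamagawaSqueeze
import Summits.BirchSwinnertonDyer.Rank1Residual.Iwasawa.RankGrowthLayerHolds
import Literature.NumberTheory.EllipticCurves.SupersingularIrreducibleProofs
import HarnessLib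

/-!
# Route `EisensteinPrimes`, line `mudescent`, crux 5 `MazurMCOnX1RankZero` (stmt-BirchSwinnertonDyer-19035):
# the X1 twin of `EisensteinPrimesX2AnalyticLambdaCertificate` — the ANALYTIC inputs of
# `stub_lambdaCount_offLocus` at a GOOD ORDINARY (anomalous) pair from ONE finite certificate, stubs
# 3 + 4 at a pair, and the per-pair main-conjecture certificate (helper; closes nothing)

Seat `bsd-eis-lam-a` g3 (PROGRAMME PART 1b, ACCEL-LIST (4); skeleton owner bsd-eis-ky,
`Lines/mudescent.lean` for `MazurMCOnX1RankZero`). X1 currency: `X1.MuPart.AnalyticMuLE W p m` and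
`X1.ParitySqueeze.AnalyticLambdaEq W p n` read THE newform `f` of `W` at level `N_E`, every `ϖ` with
`ϖ·Ω_E = Ω⁺_f`, and the prelude's good-reduction `L_p = padicLFunction f (unitRoot W p)`.

HONEST FRAMING. THEOREMS ONLY — no definition, no new named fact; nothing about any particular
curve is asserted (the coefficient / Birch-sum equalities are hypotheses an instrument's exact symbol
table is EVIDENCE for); closes nothing; moves no label.

* §1 `datum_unique` (at level `N_E` the newform and `ϖ` are unique), `analyticMuLE_iff_of_datum`,
  `analyticLambdaEq_iff_of_datum`.
* §2 certificates ⇒ typed inputs: a unit coefficient of index `m` of `ϖ·L_p` (`AnalyticMuLE W p 0`,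
  `∃ n ≤ m, AnalyticLambdaEq W p n`); the FIRST unit coefficient at `n` (`AnalyticLambdaEq W p n`);
  ONE Birch sum `|ϖ·∑_a χ(a)[a/p^{n+1+e₀}]⁺_f|^{φ(pⁿ⁺¹)} = p^{−V}`, `V < φ(pⁿ⁺¹)`
  (`AnalyticMuLE W p 0 ∧ AnalyticLambdaEq W p V`; tree `Iwasawa.ordinary_mu_eq_zero_and_lam_eq_of_norm_twist_pow_eq`,
  interpolation = tree theorem at a good ordinary prime); a VANISHING Birch sum of conductor
  `p^{n+1+e₀}` forces `φ(pⁿ⁺¹) ≤ λ_an` (torsion-point zeros; MEMO-2 §4b: at `186@5`, `λ_an = 6` of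
  which `φ(5) = 4` sit at the conductor-`25` characters, one vanishing orbit).
* §3 stubs 3 + 4 AT A PAIR from a unit coefficient of index `m`, `AlgebraicLambdaGE W p k`, `m ≤ k`
  (`lambdaCount_of_norm_coeff_eq_one_of_algebraicLambdaGE`: the registered X1 conclusion verbatim and
  `AnalyticMuLE W p 0`); Mazur's main conjecture at the pair by route T (`X1.TamagawaSqueeze`,
  Wuthrich Thm. 16 `hW16`); END-TO-END at an étale end WITHOUT rational `p`-torsion (lam-b's δ = 0
  road p471892 `X1.algebraicLambdaGE_of_dvd_localTamagawaNumber`: `S` places `v ∤ p` with `p ∣ c_v`,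
  `m ≤ #S`); and the ASCEND to every isogenous X1 rank-0 member (`Rank1ResidualX1Isogeny`). The δ = 1
  road at a good anomalous prime (rational `p`-torsion: Greenberg's `a`-term from `Ẽ(𝔽_p)[p] ≠ 0`)
  has no discharged local kernel class in the tree yet (lam-b HANDOFF (i)); when it lands, §3's first
  two theorems consume it unchanged.

References: [GreenbergVatsal2000] (1)–(2); [MazurTateTeitelbaum1986Invent] §I.13–I.14;
[MazurSwinnertonDyer1974Invent] §9; [Washington1997] §7.1–7.2; [GreenbergLNM1716] Cor. 5.6 (p. 136);
[Wuthrich2014] Thm. 16; HOME/lam-a-g2/lam-a-MEMO-2.md §4b.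
-/

set_option linter.dupNamespace false
set_option autoImplicit false

noncomputable section

open scoped Classical MatrixGroups ModularForm

open PowerSeries CongruenceSubgroup WeierstrassCurve NumberField IsDedekindDomain
  Literature.NumberTheory.EllipticCurves
  Literature.NumberTheory.EllipticCurves.ModularForms
  Literature.NumberTheory.EllipticCurves.Rank1Residual
  Literature.NumberTheory.EllipticCurves.GreenbergVatsal2000
  Literature.NumberTheory.EllipticCurves.Greenberg1999
  Literature.NumberTheory.GaloisCohomology
  Summit.BirchSwinnertonDyer.Rank1Residual
  Summit.BirchSwinnertonDyer.Rank1Residual.X1.MuLambda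
  Summit.BirchSwinnertonDyer.Rank1Residual.X1.MuPart
  Summit.BirchSwinnertonDyer.Rank1Residual.X1.ParitySqueeze
  Summit.BirchSwinnertonDyer.Rank1Residual.X1.TamagawaSqueeze
  Summit.BirchSwinnertonDyer.Rank1Residual.X11a
  Summit.BirchSwinnertonDyer.Rank1Residual.X11a.LambdaNorm
  Summit.BirchSwinnertonDyer.Rank1Residual.Iwasawa
  Summit.BirchSwinnertonDyer.BirchSwinnertonDyer.Theorems
  Summit.BirchSwinnertonDyer.BirchSwinnertonDyer.Theorems.Rank1ResidualX1Defs
  Summit.BirchSwinnertonDyer.BirchSwinnertonDyer.Theorems.EisensteinPrimesX2AnalyticLambdaCertificate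
  Summit.BirchSwinnertonDyer.BirchSwinnertonDyer.Theorems.EisensteinPrimesX1AlgebraicLambdaGEBudget

namespace Summit.BirchSwinnertonDyer.BirchSwinnertonDyer.Theorems.EisensteinPrimesX1AnalyticLambdaCertificate

variable {W : WeierstrassCurve ℚ} [W.IsElliptic] [W.IsGloballyMinimal] {p : ℕ} [hp : Fact p.Prime]

/-! ## §1. At level `N_E` the datum `(f, ϖ)` is unique -/

section Datum

variable [NeZero (W.conductorNorm ℤ)] {f : CuspForm (Gamma0 (W.conductorNorm ℤ)) 2} {ϖ : ℚ}

omit [W.IsElliptic] [W.IsGloballyMinimal] in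
/-- **The datum is unique**: two newforms of `W` at level `N_E` coincide (multiplicity one,
`IsNewformOf.unique`), and `ϖ` is determined by `ϖ·Ω_E = Ω⁺_f` (`Ω_E ≠ 0`). [cite: AtkinLehner1970, Thm. 4] -/
theorem datum_unique (hf : IsNewformOf W f) (hϖ : (ϖ : ℝ) * W.realPeriodRat = plusPeriod f)
    {f' : CuspForm (Gamma0 (W.conductorNorm ℤ)) 2} (hf' : IsNewformOf W f') {ϖ' : ℚ}
    (hϖ' : (ϖ' : ℝ) * W.realPeriodRat = plusPeriod f') : f' = f ∧ ϖ' = ϖ := by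
  obtain rfl : f = f' := hf.unique hf'
  obtain ⟨-, hΩ⟩ := EisensteinPrimesAnalyticLambdaCalculus.varpi_ne_zero_and_realPeriodRat_ne_zero hf hϖ
  refine ⟨rfl, ?_⟩
  have h : (ϖ' : ℝ) * W.realPeriodRat = (ϖ : ℝ) * W.realPeriodRat := by rw [hϖ', hϖ]
  exact_mod_cast mul_right_cancel₀ hΩ h

/-- **`X1.MuPart.AnalyticMuLE W p m` read on the datum.** [cite: GreenbergVatsal2000, p. 2, (2)] -/
theorem analyticMuLE_iff_of_datum (hf : IsNewformOf W f)
    (hϖ : (ϖ : ℝ) * W.realPeriodRat = plusPeriod f) (m : ℕ) :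
    AnalyticMuLE W p m ↔ ∃ k : ℕ, (p : ℝ) ^ (-((m : ℤ) + 1)) <
      ‖PowerSeries.coeff k (PowerSeries.C (ϖ : ℚ_[p]) * padicLFunction f (unitRoot W p : ℚ_[p]))‖ := by
  refine ⟨fun h ↦ h f hf ϖ hϖ, fun h ↦ ?_⟩
  intro _ f' hf' ϖ' hϖ'
  obtain ⟨rfl, rfl⟩ := datum_unique hf hϖ hf' hϖ'
  exact h

/-- **`X1.ParitySqueeze.AnalyticLambdaEq W p n` read on the datum.** [cite: GreenbergVatsal2000, p. 2–3, (1)–(2)] -/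
theorem analyticLambdaEq_iff_of_datum (hf : IsNewformOf W f)
    (hϖ : (ϖ : ℝ) * W.realPeriodRat = plusPeriod f) (n : ℕ) :
    AnalyticLambdaEq W p n ↔ ∀ g : IwasawaAlgebra p, iwasawaToPowerSeries p g =
      PowerSeries.C (ϖ : ℚ_[p]) * padicLFunction f (unitRoot W p : ℚ_[p]) → lam g = n := by
  refine ⟨fun h g hg ↦ h f hf ϖ hϖ g hg, fun h ↦ ?_⟩
  intro _ f' hf' ϖ' hϖ' g hg
  obtain ⟨rfl, rfl⟩ := datum_unique hf hϖ hf' hϖ'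
  exact h g hg

end Datum

/-! ## §2. Certificates ⇒ the typed analytic inputs (good ordinary `p`) -/

section Certificates

variable [NeZero (W.conductorNorm ℤ)] {f : CuspForm (Gamma0 (W.conductorNorm ℤ)) 2} {ϖ : ℚ}

/-- **A UNIT COEFFICIENT gives `μ_an = 0`** (X1). [cite: GreenbergVatsal2000, p. 2, (2)] -/
theorem analyticMuLE_zero_of_norm_coeff_eq_one (hf : IsNewformOf W f)
    (hϖ : (ϖ : ℝ) * W.realPeriodRat = plusPeriod f) {m : ℕ}
    (hm : ‖PowerSeries.coeff m
      (PowerSeries.C (ϖ : ℚ_[p]) * padicLFunction f (unitRoot W p : ℚ_[p]))‖ = 1) :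
    AnalyticMuLE W p 0 := by
  refine (analyticMuLE_iff_of_datum hf hϖ 0).mpr ⟨m, ?_⟩
  rw [hm]
  have hp1 : (1 : ℝ) < p := by exact_mod_cast hp.out.one_lt
  have : (p : ℝ) ^ (-(((0 : ℕ) : ℤ) + 1)) = (p : ℝ)⁻¹ := by simp
  rw [this]
  exact inv_lt_one_of_one_lt₀ hp1

/-- **A unit coefficient of index `m` gives `λ_an ≤ m`** (X1): `∃ n ≤ m, AnalyticLambdaEq W p n`.
[cite: GreenbergVatsal2000, p. 2–3, (1)–(2)] [cite: Washington1997, §7.1] -/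
theorem exists_analyticLambdaEq_le_of_norm_coeff_eq_one (hf : IsNewformOf W f)
    (hϖ : (ϖ : ℝ) * W.realPeriodRat = plusPeriod f) {m : ℕ}
    (hm : ‖PowerSeries.coeff m
      (PowerSeries.C (ϖ : ℚ_[p]) * padicLFunction f (unitRoot W p : ℚ_[p]))‖ = 1) :
    ∃ n ≤ m, AnalyticLambdaEq W p n := by
  by_cases hex : ∃ g : IwasawaAlgebra p,
      iwasawaToPowerSeries p g = PowerSeries.C (ϖ : ℚ_[p]) * padicLFunction f (unitRoot W p : ℚ_[p])
  · obtain ⟨g, hg⟩ := hex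
    obtain ⟨-, -, hle⟩ := lam_le_of_norm_coeff_iota_eq_one hg hm
    refine ⟨lam g, hle, (analyticLambdaEq_iff_of_datum hf hϖ _).mpr fun g' hg' ↦ ?_⟩
    rw [iwasawaToPowerSeries_injective p (hg'.trans hg.symm)]
  · exact ⟨0, Nat.zero_le _, (analyticLambdaEq_iff_of_datum hf hϖ _).mpr
      fun g' hg' ↦ absurd ⟨g', hg'⟩ hex⟩

/-- **The FIRST unit coefficient gives `λ_an` exactly** (X1): `‖[T^j](ϖ·L_p)‖ < 1` for `j < n` and
`‖[T^n](ϖ·L_p)‖ = 1` ⇒ `AnalyticMuLE W p 0 ∧ AnalyticLambdaEq W p n` — the shape of iw-2's two-engine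
`(μ, λ)` census certificate on class X1. [cite: Washington1997, §7.1 (Prop. 7.2, Thm. 7.3)]
[cite: GreenbergVatsal2000, p. 2–3, (1)–(2)] -/
theorem analyticMuLE_zero_and_analyticLambdaEq_of_firstUnitCoeff (hf : IsNewformOf W f)
    (hϖ : (ϖ : ℝ) * W.realPeriodRat = plusPeriod f) {n : ℕ}
    (hlow : ∀ j < n, ‖PowerSeries.coeff j
      (PowerSeries.C (ϖ : ℚ_[p]) * padicLFunction f (unitRoot W p : ℚ_[p]))‖ < 1)
    (hn : ‖PowerSeries.coeff n
      (PowerSeries.C (ϖ : ℚ_[p]) * padicLFunction f (unitRoot W p : ℚ_[p]))‖ = 1) :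
    AnalyticMuLE W p 0 ∧ AnalyticLambdaEq W p n := by
  refine ⟨analyticMuLE_zero_of_norm_coeff_eq_one hf hϖ hn,
    (analyticLambdaEq_iff_of_datum hf hϖ n).mpr fun g hg ↦ ?_⟩
  have hcoe := norm_coeff_eq_of_iota_eq hg
  have hgn : ‖PowerSeries.coeff n g‖ = 1 := by rw [hcoe]; exact hn
  have hex : ∃ k, ‖PowerSeries.coeff k g‖ = 1 := ⟨n, hgn⟩
  have hunit : HasUnitContent g := (hasUnitContent_iff_exists_norm_eq_one g).mpr hex
  rw [lam_eq_normLam hunit, normLam_eq_iff (hasMaxCoeff_of_exists_norm_eq_one hex) n]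
  refine ⟨isMaxCoeffAt_of_norm_eq_one hgn, fun j hj ↦ ?_⟩
  rw [hgn, hcoe]
  exact hlow j hj

/-- **ONE BIRCH SUM certifies `μ_an = 0` AND `λ_an` at a good ORDINARY prime** (X1). `g` an integral
model (`ι g = ϖ·L_p`; Wuthrich / the census's `c_den = 0`), `χ` ONE primitive even `p`-power-order
character of conductor `p^{n+1+e₀}` with values in `ℂ_p`, `|ϖ·∑_a χ(a)[a/p^{n+1+e₀}]⁺_f|^{φ(pⁿ⁺¹)} =
p^{−V}`, `V < φ(pⁿ⁺¹)` ⇒ `AnalyticMuLE W p 0 ∧ AnalyticLambdaEq W p V` (interpolation at `α = unitRoot`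
is the tree theorem `isPAdicLFunctionOf_padicLFunction_holds`). At `p = 5`, `n = 0`: `λ_an ≤ 3` from one
value at conductor `25`; `p = 3`, `n = 1`: `λ_an ≤ 5` from one value at conductor `27`.
[cite: MazurSwinnertonDyer1974Invent, §9] [cite: MazurTateTeitelbaum1986Invent, §I.14 (14.3)]
[cite: Washington1997, §7.1–7.2 and Thm. 7.3] -/
theorem analyticMuLE_zero_and_analyticLambdaEq_of_norm_twist_pow_eq (hord : IsOrdinaryAt W p)
    (hf : IsNewformOf W f) (hϖ : (ϖ : ℝ) * W.realPeriodRat = plusPeriod f) {g : IwasawaAlgebra p}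
    (hg : iwasawaToPowerSeries p g =
      PowerSeries.C (ϖ : ℚ_[p]) * padicLFunction f (unitRoot W p : ℚ_[p]))
    {n : ℕ} (χ : DirichletCharacter ℂ_[p] (p ^ (n + 1 + cyclotomicExponent p)))
    (hχ : χ.IsPrimitive) (heven : χ.Even) (hordχ : ∃ j : ℕ, orderOf χ = p ^ j) {V : ℕ}
    (hV : V < Nat.totient (p ^ (n + 1)))
    (h : ‖algebraMap ℚ_[p] ℂ_[p] (ϖ : ℚ_[p]) * ratTwistedSymbolSum f χ‖ ^ Nat.totient (p ^ (n + 1)) =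
      ((p : ℝ)⁻¹) ^ V) :
    AnalyticMuLE W p 0 ∧ AnalyticLambdaEq W p V := by
  have hI := (isPAdicLFunctionOf_padicLFunction_holds hord hf).2
  -- `g ≠ 0`: otherwise the value vanishes, but `p^{-V} ≠ 0`
  have hg0 : g ≠ 0 := by
    intro hg0
    have hsum := hasSum_integralModel_eq_ratTwistedSymbolSum hI hg
      (by omega : 0 < n + 1 + cyclotomicExponent p) χ hχ heven hordχ
    rw [hg0] at hsum
    have hzero : algebraMap ℚ_[p] ℂ_[p] (ϖ : ℚ_[p]) *
        (algebraMap ℚ_[p] ℂ_[p] ((unitRoot W p : ℚ_[p])⁻¹ ^ (n + 1 + cyclotomicExponent p)) *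
          ratTwistedSymbolSum f χ) = 0 := by
      refine hsum.unique ?_
      simp
    have h' : ‖algebraMap ℚ_[p] ℂ_[p] (ϖ : ℚ_[p]) * ratTwistedSymbolSum f χ‖ = 0 := by
      have := congrArg (‖·‖) hzero
      simp only [norm_mul, norm_zero, norm_algebraMap_unitRoot_inv_pow hord, one_mul] at this
      rw [norm_mul]; exact this
    rw [h', zero_pow (Nat.totient_pos.mpr (pow_pos hp.out.pos _)).ne'] at h
    exact absurd h (pow_pos (inv_pos.mpr (by exact_mod_cast hp.out.pos)) V).ne
  obtain ⟨hμ, hlam⟩ :=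
    ordinary_mu_eq_zero_and_lam_eq_of_norm_twist_pow_eq hord hf hg hg0 χ hχ heven hordχ hV h
  have hunit : HasUnitContent g := hasUnitContent_of_mu_eq_zero hg0 hμ
  obtain ⟨k, hk⟩ := (hasUnitContent_iff_exists_norm_eq_one g).mp hunit
  rw [norm_coeff_eq_of_iota_eq hg] at hk
  refine ⟨analyticMuLE_zero_of_norm_coeff_eq_one hf hϖ hk,
    (analyticLambdaEq_iff_of_datum hf hϖ V).mpr fun g' hg' ↦ ?_⟩
  rw [iwasawaToPowerSeries_injective p (hg'.trans hg.symm), hlam]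

/-- **A VANISHING BIRCH SUM of conductor `p^{n+1+e₀}` forces `λ_an ≥ φ(pⁿ⁺¹)`** (X1, good ordinary
`p`): with an integral model `g ≠ 0` and `∑_a χ(a)[a/p^{n+1+e₀}]⁺_f = 0` (a vanishing twist
`L(E, χ̄, 1) = 0` of order `pⁿ⁺¹`), every certified `AnalyticLambdaEq W p n'` has `φ(pⁿ⁺¹) ≤ n'` —
the kernel face of MEMO-2 §4b's torsion-point zeros on row A3 (`186@5`: `λ_an = 6`, four of the six
zeros at the conductor-`25` characters). [cite: MazurTateTeitelbaum1986Invent, §I.13–I.14]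
[cite: Washington1997, §7.1–7.2] -/
theorem totient_le_of_analyticLambdaEq_of_twist_eq_zero (hord : IsOrdinaryAt W p)
    (hf : IsNewformOf W f) (hϖ : (ϖ : ℝ) * W.realPeriodRat = plusPeriod f) {g : IwasawaAlgebra p}
    (hg : iwasawaToPowerSeries p g =
      PowerSeries.C (ϖ : ℚ_[p]) * padicLFunction f (unitRoot W p : ℚ_[p]))
    (hg0 : g ≠ 0) {n : ℕ} (χ : DirichletCharacter ℂ_[p] (p ^ (n + 1 + cyclotomicExponent p)))
    (hχ : χ.IsPrimitive) (heven : χ.Even) (hordχ : ∃ j : ℕ, orderOf χ = p ^ j)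
    (hzero : ratTwistedSymbolSum f χ = 0) {n' : ℕ} (hn' : AnalyticLambdaEq W p n') :
    Nat.totient (p ^ (n + 1)) ≤ n' := by
  have hI := (isPAdicLFunctionOf_padicLFunction_holds hord hf).2
  have hsum := hasSum_integralModel_eq_ratTwistedSymbolSum hI hg
    (by omega : 0 < n + 1 + cyclotomicExponent p) χ hχ heven hordχ
  rw [hzero, mul_zero, mul_zero] at hsum
  rw [← (analyticLambdaEq_iff_of_datum hf hϖ n').mp hn' g hg]
  exact totient_le_lam_of_hasSum_zero hg0 (isPrimitiveRoot_apply_cyclotomicGenerator χ hχ heven hordχ)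
    hsum

end Certificates

/-! ## §3. Stubs 3 + 4 at an X1 pair, Mazur's main conjecture at the pair, and the ascent -/

section AtPair

/-- **Stubs 3 and 4 of `mudescent` (X1) AT A PAIR, from certificates**: a unit coefficient of index
`m` of `ϖ·L_p` (for THE newform at level `N_E` and its `ϖ`), `AlgebraicLambdaGE W p k`, `m ≤ k` ⇒
`AnalyticMuLE W p 0` and the registered X1 conclusion `∃ n k, AnalyticLambdaEq W p n ∧
AlgebraicLambdaGE W p k ∧ n ≤ k`. [cite: GreenbergVatsal2000, p. 2–3, (1)–(2)]
[cite: GreenbergLNM1716, Cor. 5.6 (p. 136)] -/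
theorem lambdaCount_of_norm_coeff_eq_one_of_algebraicLambdaGE {m k : ℕ}
    (hcoeff : ∀ [NeZero (W.conductorNorm ℤ)] (f : CuspForm (Gamma0 (W.conductorNorm ℤ)) 2),
      IsNewformOf W f → ∀ (ϖ : ℚ), (ϖ : ℝ) * W.realPeriodRat = plusPeriod f →
      ‖PowerSeries.coeff m (PowerSeries.C (ϖ : ℚ_[p]) * padicLFunction f (unitRoot W p : ℚ_[p]))‖ = 1)
    (halg : AlgebraicLambdaGE W p k) (hmk : m ≤ k) :
    AnalyticMuLE W p 0 ∧ ∃ n k : ℕ, AnalyticLambdaEq W p n ∧ AlgebraicLambdaGE W p k ∧ n ≤ k := by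
  haveI : NeZero (W.conductorNorm ℤ) := ⟨(W.conductorNorm_pos_holds).ne'⟩
  by_cases hex : ∃ (f : CuspForm (Gamma0 (W.conductorNorm ℤ)) 2) (ϖ : ℚ),
      IsNewformOf W f ∧ (ϖ : ℝ) * W.realPeriodRat = plusPeriod f
  · obtain ⟨f, ϖ, hf, hϖ⟩ := hex
    have hm := hcoeff f hf ϖ hϖ
    obtain ⟨n, hle, hn⟩ := exists_analyticLambdaEq_le_of_norm_coeff_eq_one hf hϖ hm
    exact ⟨analyticMuLE_zero_of_norm_coeff_eq_one hf hϖ hm, n, k, hn, halg, hle.trans hmk⟩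
  · refine ⟨?_, 0, k, ?_, halg, Nat.zero_le _⟩
    · intro _ f hf ϖ hϖ; exact absurd ⟨f, ϖ, hf, hϖ⟩ hex
    · intro _ f hf ϖ hϖ g hg; exact absurd ⟨f, ϖ, hf, hϖ⟩ hex

/-- **Mazur's main conjecture AT AN X1 PAIR from certificates** (`p ≠ 2` good ordinary, `E[p]`
reducible): unit coefficient of index `m`, `AlgebraicLambdaGE W p k`, `m ≤ k` ⇒ `MazurMainConjecture W p`
(μ-part `X1.MuPart.muPartAt_of_analyticMuLE_zero` + route T
`X1.TamagawaSqueeze.mazurMainConjecture_of_algebraicLambdaGE`; Wuthrich Thm. 16 `hW16`).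
[cite: Wuthrich2014, Thm. 16 (p. 397)] [cite: GreenbergVatsal2000, p. 4] -/
theorem mazurMainConjecture_of_norm_coeff_eq_one_of_algebraicLambdaGE
    (hW16 : Wuthrich2014.charIdeal_dvd_padicLFunction) (hp2 : p ≠ 2)
    (hgood : W.HasGoodReductionAtPrime p) (hord : ¬ (p : ℤ) ∣ W.frobeniusTrace p)
    (hred : ¬ W.HasIrreducibleModPGaloisRep p) {m k : ℕ}
    (hcoeff : ∀ [NeZero (W.conductorNorm ℤ)] (f : CuspForm (Gamma0 (W.conductorNorm ℤ)) 2),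
      IsNewformOf W f → ∀ (ϖ : ℚ), (ϖ : ℝ) * W.realPeriodRat = plusPeriod f →
      ‖PowerSeries.coeff m (PowerSeries.C (ϖ : ℚ_[p]) * padicLFunction f (unitRoot W p : ℚ_[p]))‖ = 1)
    (halg : AlgebraicLambdaGE W p k) (hmk : m ≤ k) : MazurMainConjecture W p := by
  obtain ⟨hμ, n, k', hn, halg', hnk⟩ := lambdaCount_of_norm_coeff_eq_one_of_algebraicLambdaGE hcoeff halg hmk
  exact X1.TamagawaSqueeze.mazurMainConjecture_of_algebraicLambdaGE hW16 hp2 hgood hord hred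
    (muPartAt_of_analyticMuLE_zero hW16 hp2 hgood hord hred hμ) hn halg' hnk

/-- **X1 pair, RANK-GROWTH road**: a unit coefficient of index `m'`, a rank-growth certificate
`LayerRankGEAt W p k m` (`rank E(ℚ_k) ≥ m`, iw-1) and `m' ≤ m` ⇒ `MazurMainConjecture W p` (Greenberg
Thm. 1.9 PROVED, binder-free `Iwasawa.algebraicLambdaGE_of_layerRankGEAt'`; route T). The algebraic
face of the torsion-point zeros (`totient_le_of_analyticLambdaEq_of_twist_eq_zero`): on row A3 this is
how `12194d1@3` / `14534b1@3`-type classes (λ_an = 4, point over `ℚ(ζ_9)⁺`) read.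
[cite: GreenbergLNM1716, Thm. 1.9 (p. 63)] [cite: Wuthrich2014, Thm. 16 (p. 397)] -/
theorem mazurMainConjecture_of_norm_coeff_eq_one_of_layerRankGEAt
    (hW16 : Wuthrich2014.charIdeal_dvd_padicLFunction) (hp2 : p ≠ 2)
    (hgood : W.HasGoodReductionAtPrime p) (hord : ¬ (p : ℤ) ∣ W.frobeniusTrace p)
    (hred : ¬ W.HasIrreducibleModPGaloisRep p) {m' k m : ℕ}
    (hcoeff : ∀ [NeZero (W.conductorNorm ℤ)] (f : CuspForm (Gamma0 (W.conductorNorm ℤ)) 2),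
      IsNewformOf W f → ∀ (ϖ : ℚ), (ϖ : ℝ) * W.realPeriodRat = plusPeriod f →
      ‖PowerSeries.coeff m' (PowerSeries.C (ϖ : ℚ_[p]) * padicLFunction f (unitRoot W p : ℚ_[p]))‖ = 1)
    (hm : LayerRankGEAt W p k m) (hle : m' ≤ m) : MazurMainConjecture W p :=
  mazurMainConjecture_of_norm_coeff_eq_one_of_algebraicLambdaGE hW16 hp2 hgood hord hred hcoeff
    (algebraicLambdaGE_of_layerRankGEAt' (Or.inl ⟨hgood, hord⟩) hm) hle

/-- `AnalyticMuLE W p 0` from a unit coefficient stated for every datum. [cite: GreenbergVatsal2000, p. 2, (2)] -/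
theorem analyticMuLE_zero_of_forall_norm_coeff_eq_one {m : ℕ}
    (hcoeff : ∀ [NeZero (W.conductorNorm ℤ)] (f : CuspForm (Gamma0 (W.conductorNorm ℤ)) 2),
      IsNewformOf W f → ∀ (ϖ : ℚ), (ϖ : ℝ) * W.realPeriodRat = plusPeriod f →
      ‖PowerSeries.coeff m (PowerSeries.C (ϖ : ℚ_[p]) * padicLFunction f (unitRoot W p : ℚ_[p]))‖ = 1) :
    AnalyticMuLE W p 0 := by
  intro _ f hf ϖ hϖ
  have hμ : AnalyticMuLE W p 0 := analyticMuLE_zero_of_norm_coeff_eq_one hf hϖ (hcoeff f hf ϖ hϖ)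
  exact hμ f hf ϖ hϖ

/-- **END-TO-END at an X1 member WITHOUT rational `p`-torsion** (lam-b's δ = 0 road p471892): `p ≠ 2`
good ordinary, `E[p]` reducible, `p ∤ #E(ℚ)_tors`, `S` places `v ∤ p` with `p ∣ c_v(W)`, and a unit
coefficient of `ϖ·L_p` at index `m ≤ #S` ⇒ `MazurMainConjecture W p`. Named print: `hW16`, `hPT`,
`h415`, `hmod`. [cite: GreenbergLNM1716, §5 pp. 114–118 and Cor. 5.6 (p. 136)] [cite: Wuthrich2014, Thm. 16 (p. 397)] -/
theorem mazurMainConjecture_of_norm_coeff_eq_one_of_dvd_localTamagawaNumber (hp2 : p ≠ 2)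
    (hPT : poitouTate_selmerStructure_duality ℚ)
    (h415 : prop415ii_noFiniteSubmodule_of_ordinary_or_multiplicative)
    (hW16 : Wuthrich2014.charIdeal_dvd_padicLFunction) (hmod : nonempty_modularParametrizationData)
    (hgood : W.HasGoodReductionAtPrime p) (hord : ¬ (p : ℤ) ∣ W.frobeniusTrace p)
    (hred : ¬ W.HasIrreducibleModPGaloisRep p) (htors : ¬ p ∣ W.torsionOrder)
    (S : Finset (HeightOneSpectrum (𝓞 ℚ))) (hSp : ∀ v ∈ S, ((p : ℕ) : 𝓞 ℚ) ∉ v.asIdeal)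
    (hcv : ∀ v ∈ S,
      p ∣ (W.baseChange (v.adicCompletion ℚ)).localTamagawaNumber (v.adicCompletionIntegers ℚ))
    {m : ℕ}
    (hcoeff : ∀ [NeZero (W.conductorNorm ℤ)] (f : CuspForm (Gamma0 (W.conductorNorm ℤ)) 2),
      IsNewformOf W f → ∀ (ϖ : ℚ), (ϖ : ℝ) * W.realPeriodRat = plusPeriod f →
      ‖PowerSeries.coeff m (PowerSeries.C (ϖ : ℚ_[p]) * padicLFunction f (unitRoot W p : ℚ_[p]))‖ = 1)
    (hmS : m ≤ S.card) : MazurMainConjecture W p := by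
  have hμ : AnalyticMuLE W p 0 := analyticMuLE_zero_of_forall_norm_coeff_eq_one hcoeff
  have halg : AlgebraicLambdaGE W p (S.card - 0) :=
    X1.algebraicLambdaGE_of_dvd_localTamagawaNumber hp2 hPT h415 hW16 hmod hgood hord hred htors S hSp
      hcv hμ
  rw [Nat.sub_zero] at halg
  exact mazurMainConjecture_of_norm_coeff_eq_one_of_algebraicLambdaGE hW16 hp2 hgood hord hred hcoeff
    halg hmS

/-- **ASCEND: Mazur's main conjecture at every X1 rank-0 member isogenous to a certified δ = 0 member**
(`Rank1ResidualX1Isogeny.mazurMainConjecture_iff_of_isIsogenous_of_analyticRank_eq_zero`, with the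
`PublishedInputs` conjuncts Greenberg 4.1 `hGr`, modularity `hmod`/`hmod'`, GZK, Cassels).
[cite: Wuthrich2014, Thm. 16 (p. 397)] [cite: GreenbergLNM1716, Cor. 5.6 (p. 136)] -/
theorem mazurMainConjecture_of_isIsogenous_of_norm_coeff_eq_one_of_dvd_localTamagawaNumber
    (hW16 : Wuthrich2014.charIdeal_dvd_padicLFunction) (hGr : greenberg_charValue_rankZero)
    (hmod : nonempty_modularParametrizationData) (hmod' : hasEntireLFunction_rat)
    (hGZK : rank_eq_analyticRank_of_analyticRank_le_one) (hCassels : bsdRHS_eq_of_isIsogenous)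
    (hPT : poitouTate_selmerStructure_duality ℚ)
    (h415 : prop415ii_noFiniteSubmodule_of_ordinary_or_multiplicative)
    (hX1 : ClassX1 W p) (hr0 : W.analyticRank = 0)
    {W₀ : WeierstrassCurve ℚ} [W₀.IsElliptic] [W₀.IsGloballyMinimal] (hiso : IsIsogenous W W₀)
    (htors : ¬ p ∣ W₀.torsionOrder)
    (S : Finset (HeightOneSpectrum (𝓞 ℚ))) (hSp : ∀ v ∈ S, ((p : ℕ) : 𝓞 ℚ) ∉ v.asIdeal)
    (hcv : ∀ v ∈ S,
      p ∣ (W₀.baseChange (v.adicCompletion ℚ)).localTamagawaNumber (v.adicCompletionIntegers ℚ))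
    {m : ℕ}
    (hcoeff : ∀ [NeZero (W₀.conductorNorm ℤ)] (f : CuspForm (Gamma0 (W₀.conductorNorm ℤ)) 2),
      IsNewformOf W₀ f → ∀ (ϖ : ℚ), (ϖ : ℝ) * W₀.realPeriodRat = plusPeriod f →
      ‖PowerSeries.coeff m (PowerSeries.C (ϖ : ℚ_[p]) * padicLFunction f (unitRoot W₀ p : ℚ_[p]))‖ = 1)
    (hmS : m ≤ S.card) : MazurMainConjecture W p := by
  have hX1₀ : ClassX1 W₀ p := ClassX1.of_isIsogenous hiso hX1
  have hp2' : 2 < p := hX1₀.1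
  have hred₀ : Red W₀ p := hX1₀.2.1
  have hgood₀ : Good W₀ p := hX1₀.2.2.1
  obtain ⟨-, hord₀⟩ := goodOrd_of_red_of_good W₀ p hp2' hgood₀ hred₀
  have hMC₀ : MazurMainConjecture W₀ p :=
    mazurMainConjecture_of_norm_coeff_eq_one_of_dvd_localTamagawaNumber (by omega) hPT h415 hW16 hmod
      hgood₀ hord₀ hred₀ htors S hSp hcv hcoeff hmS
  exact (Rank1ResidualX1Isogeny.mazurMainConjecture_iff_of_isIsogenous_of_analyticRank_eq_zero hW16 hGr
    hmod hmod' hGZK hCassels W W₀ hiso p hX1 hr0).mpr hMC₀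

end AtPair

end Summit.BirchSwinnertonDyer.BirchSwinnertonDyer.Theorems.EisensteinPrimesX1AnalyticLambdaCertificate

end
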